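import Literature.NumberTheory.GaloisRepresentations.GrossencharakterConductor
import HarnessLib

/-!
# The CONDUCTOR IDEAL `𝔣(χ) = ∏_v 𝔭_v^{f(χ_v)}` of an idelic Hecke character — definition and basic API

Topic `NumberTheory/GaloisRepresentations`; namespace `Literature.NumberTheory.GaloisRepresentations.HeckeCharacter`.  ONE DEFINITION
(`HeckeCharacter.conductor`, with body) and proved API; no named fact, no instance, no notation, no `sorry`.

`HeckeCharacterConductorExponent.lean` records the gap «the tree has no conductor ideal of an idelic Hecke character» and supplies the
LOCAL exponents `f(χ_v) = conductorExponentAt χ v` (Li–Xu §2.1.1; Tate §2.3; Neukirch VII (6.10)–(6.11)); `HeckeCharacterConductorExponentProofs.lean`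
proves they exist and vanish off the finite ramified set; `HeckeCharacterSharpModulusProofs.lean` / `GrossencharakterConductor.lean` prove that
`(ram χ, f(χ_·))` is a module of definition and that the ideal character is a Größencharakter modulo `∏_{v ∈ ram χ} 𝔭_v^{f(χ_v)}`, with that
product written out.  This file NAMES the product — Neukirch, *Algebraic Number Theory* VII (6.11): «`𝔣 = 𝔣(χ)` … the conductor of `χ`, the
smallest module of definition» — and restates the API on the name:

* `conductor χ := ∏_{v ∈ ram χ} 𝔭_v^{f(χ_v)}`; `conductor_ne_bot`; `conductor_le_asIdeal_iff` (the primes of `𝔣(χ)` are exactly the ramified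
  places); `modulusExp_conductor` (`ν_v(𝔣(χ)) = f(χ_v)` at every `v`);
* minimality: `conductorExponentAt_le_of_isModulus` (every module of definition `(T, e)` has `f(χ_v) ≤ e_v` on `T`), `conductor_dvd_of_isModulus`
  (`∏_{v∈T} 𝔭_v^{e_v} ⊆ 𝔣(χ)`, i.e. `𝔣(χ)` divides every sharp module of definition);
* `isGrossencharakter_valueAtUniformizer_conductor'` — the ideal character of an algebraic `χ` of type `(p, q)` is a Größencharakter mod `𝔣(χ)`;
* `le_conductor_heckeOfGross` — for a datum `ψ mod 𝔣`, `𝔣 ⊆ 𝔣(ω)` for `ω = heckeOfGross h𝔣 hψ` (the conductor divides the modulus).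

References: [NeukirchANT1999] Ch. VII §6 (6.10)–(6.11), Prop. (6.13), Cor. (6.14); [TateThesis1967] §2.3; [LiXu2026] §2.1.1.
`lean search 'HeckeCharacter.conductor\b|def conductor .*HeckeCharacter'` (2026-08-31): only `WeilDeligneRep.conductor`, `ArtinRep.artinConductorNat`, the
exponent files above — no conductor IDEAL of a Hecke character.
-/

noncomputable section

open scoped NumberField Classical
open NumberField IsDedekindDomain

namespace Literature.NumberTheory.GaloisRepresentations

namespace HeckeCharacter

variable {K : Type} [Field K] [NumberField K]

/-- **The conductor ideal `𝔣(χ) = ∏_{v ∈ ram χ} 𝔭_v^{f(χ_v)}`** of an idelic Hecke character: the product, over the (finitely many,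
`finite_ramifiedPlaces_holds`) ramified places, of the prime powers with the local conductor exponents (`conductorExponentAt`; the exponent is
`0` exactly at the unramified places, `conductorExponentAt_eq_zero_iff`).  Neukirch VII (6.11): the conductor is the smallest module of
definition (`isModulus_conductorExponentAt`, `conductor_dvd_of_isModulus`). [cite: NeukirchANT1999, Ch. VII §6 Def. (6.11)] [cite: TateThesis1967, §2.3] -/
def conductor (χ : HeckeCharacter K) : Ideal (𝓞 K) :=
  ∏ v ∈ (finite_ramifiedPlaces_holds χ).toFinset, v.asIdeal ^ χ.conductorExponentAt v

/-- Unfolding the definition. [cite: NeukirchANT1999, Ch. VII §6 Def. (6.11)] -/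
theorem conductor_def (χ : HeckeCharacter K) :
    χ.conductor = ∏ v ∈ (finite_ramifiedPlaces_holds χ).toFinset, v.asIdeal ^ χ.conductorExponentAt v := rfl

/-- `𝔣(χ) ≠ 0`. [cite: NeukirchANT1999, Ch. VII §6 Def. (6.11)] -/
theorem conductor_ne_bot (χ : HeckeCharacter K) : χ.conductor ≠ ⊥ :=
  prod_pow_asIdeal_ne_bot _ _

/-- **The primes of `𝔣(χ)` are exactly the ramified places of `χ`.** [cite: NeukirchANT1999, Ch. VII §6 (6.10)–(6.11)] -/
theorem conductor_le_asIdeal_iff (χ : HeckeCharacter K) (w : HeightOneSpectrum (𝓞 K)) :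
    χ.conductor ≤ w.asIdeal ↔ ¬ χ.IsUnramifiedAt w := by
  rw [conductor_def, prod_pow_asIdeal_le_iff fun v hv => χ.conductorExponentAt_pos_of_mem_toFinset hv, mem_toFinset_ramifiedPlaces_iff]

/-- The multiplicity of `𝔭_v` in a product of distinct prime powers `∏_{w∈T} 𝔭_w^{e_w}` is `e_v` on `T` and `0` off `T` (unique factorisation).
[cite: NeukirchANT1999, Ch. I §3 (3.3)] -/
theorem modulusExp_prod_pow_asIdeal (T : Finset (HeightOneSpectrum (𝓞 K))) (e : HeightOneSpectrum (𝓞 K) → ℕ) (v : HeightOneSpectrum (𝓞 K)) :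
    modulusExp (∏ w ∈ T, w.asIdeal ^ e w) v = if v ∈ T then e v else 0 := by
  classical
  unfold modulusExp
  have hv : Irreducible (Associates.mk v.asIdeal) := Associates.irreducible_mk.mpr v.irreducible
  induction T using Finset.induction_on with
  | empty =>
    rw [Finset.prod_empty, Ideal.one_eq_top, if_neg (Finset.notMem_empty v)]
    have h1 : Associates.mk (⊤ : Ideal (𝓞 K)) = 1 := by rw [← Ideal.one_eq_top, Associates.mk_one]
    rw [h1, Associates.factors_one]
    exact Associates.count_zero hv
  | insert w T hw ih =>
    rw [Finset.prod_insert hw]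
    have hne₁ : Associates.mk (w.asIdeal ^ e w) ≠ 0 := by
      rw [Ne, Associates.mk_eq_zero]; exact pow_ne_zero _ w.ne_bot
    have hne₂ : Associates.mk (∏ x ∈ T, x.asIdeal ^ e x : Ideal (𝓞 K)) ≠ 0 := by
      rw [Ne, Associates.mk_eq_zero]
      exact Finset.prod_ne_zero_iff.mpr fun x _ => pow_ne_zero _ x.ne_bot
    rw [← Associates.mk_mul_mk, Associates.count_mul hne₁ hne₂ hv, ih, Associates.mk_pow,
      Associates.count_pow (by rw [Ne, Associates.mk_eq_zero]; exact w.ne_bot) hv]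
    have hw' : Irreducible (Associates.mk w.asIdeal) := Associates.irreducible_mk.mpr w.irreducible
    by_cases hvw : v = w
    · subst hvw
      rw [Associates.count_self hv, mul_one, if_pos (Finset.mem_insert_self _ _), if_neg hw, add_zero]
    · have hne : Associates.mk v.asIdeal ≠ Associates.mk w.asIdeal := fun h => hvw (by
        have h' := Associates.mk_eq_mk_iff_associated.mp h
        exact HeightOneSpectrum.ext (associated_iff_eq.mp h'))
      rw [Associates.count_eq_zero_of_ne hv hw' hne, mul_zero, zero_add]
      by_cases hvT : v ∈ T
      · rw [if_pos hvT, if_pos (Finset.mem_insert_of_mem hvT)]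
      · rw [if_neg hvT, if_neg (by rw [Finset.mem_insert]; exact not_or.mpr ⟨hvw, hvT⟩)]

/-- **`ν_v(𝔣(χ)) = f(χ_v)`** at every finite place (off the ramified set both sides vanish). [cite: NeukirchANT1999, Ch. VII §6 Def. (6.11)] -/
theorem modulusExp_conductor (χ : HeckeCharacter K) (v : HeightOneSpectrum (𝓞 K)) :
    modulusExp χ.conductor v = χ.conductorExponentAt v := by
  rw [conductor_def, modulusExp_prod_pow_asIdeal]
  split_ifs with hv
  · rfl
  · exact ((conductorExponentAt_eq_zero_iff χ v).mpr (not_not.mp ((mem_toFinset_ramifiedPlaces_iff χ v).not.mp hv))).symm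

/-- **Minimality of the conductor exponents**: every module of definition `(T, e)` has `f(χ_v) ≤ e_v` for `v ∈ T`.
[cite: NeukirchANT1999, Ch. VII §6 (6.11) («the smallest module of definition»)] -/
theorem conductorExponentAt_le_of_isModulus {χ : HeckeCharacter K} {T : Finset (HeightOneSpectrum (𝓞 K))}
    {e : HeightOneSpectrum (𝓞 K) → ℕ} (hmod : χ.IsModulus T e) {v : HeightOneSpectrum (𝓞 K)} (hv : v ∈ T) :
    χ.conductorExponentAt v ≤ e v :=
  conductorExponentAt_le_of_isTrivialOnHigherUnitsAt (hmod.isTrivialOnHigherUnitsAt hv)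

/-- **The conductor divides every (sharp) module of definition**: `∏_{v∈T} 𝔭_v^{e_v} ⊆ 𝔣(χ)` for a module of definition `(T, e)`.
[cite: NeukirchANT1999, Ch. VII §6 (6.11)] -/
theorem prod_pow_le_conductor_of_isModulus {χ : HeckeCharacter K} {T : Finset (HeightOneSpectrum (𝓞 K))}
    {e : HeightOneSpectrum (𝓞 K) → ℕ} (hmod : χ.IsModulus T e) :
    (∏ v ∈ T, v.asIdeal ^ e v : Ideal (𝓞 K)) ≤ χ.conductor := by
  classical
  rw [conductor_def]
  refine le_prod_pow_of_forall_le_modulusExp (prod_pow_asIdeal_ne_bot T e) fun v hv => ?_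
  rw [modulusExp_prod_pow_asIdeal]
  -- a ramified place lies in every module of definition
  have hvT : v ∈ T := by
    by_contra h
    exact (mem_toFinset_ramifiedPlaces_iff χ v).mp hv (isUnramifiedAt_of_isModulus' hmod h)
  rw [if_pos hvT]
  exact conductorExponentAt_le_of_isModulus hmod hvT

/-- **The ideal character of an algebraic Hecke character is a Größencharakter modulo its conductor `𝔣(χ)`.**
[cite: NeukirchANT1999, Ch. VII §6 (6.11), Prop. (6.13), Cor. (6.14)] -/
theorem isGrossencharakter_valueAtUniformizer_conductor' {χ : HeckeCharacter K} {p q : InfinitePlace K → ℤ}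
    (hinf : χ.HasInfinityType p q) : IsGrossencharakter χ.conductor p q (fun v => χ.valueAtUniformizer v) :=
  isGrossencharakter_valueAtUniformizer_conductor hinf

end HeckeCharacter

/-- **The conductor of the Hecke character of a datum `ψ mod 𝔣` divides `𝔣`**: `𝔣 ⊆ 𝔣(ω)` for `ω = heckeOfGross h𝔣 hψ`.
[cite: NeukirchANT1999, Ch. VII §6 (6.11) and Cor. (6.14)] -/
theorem le_conductor_heckeOfGross {K : Type} [Field K] [NumberField K] {𝔣 : Ideal (𝓞 K)} {p q : InfinitePlace K → ℤ}
    {ψ : HeightOneSpectrum (𝓞 K) → ℂ} (h𝔣 : 𝔣 ≠ ⊥) (hψ : IsGrossencharakter 𝔣 p q ψ) :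
    𝔣 ≤ (heckeOfGross h𝔣 hψ).conductor :=
  hψ.le_conductor h𝔣

end Literature.NumberTheory.GaloisRepresentations

end
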